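import Literature.NumberTheory.LFunctions.Zhang2022.MainTermFormCauchySchwarz

/-!
# The functional-equation reflection `R̃g(y) = conj g(1−y)` preserves the main-term form `𝔅`

Y. Zhang, *Discrete mean estimates and the Landau–Siegel zero*, arXiv:2211.02515v1 (2022)
[Zhang2022LandauSiegel] — an unrefereed manuscript under adjudication; nothing here is a claim
about its Theorems 1–2 or about Landau–Siegel zeros. Repair rung F-S1R (human ruling D-0077),
structural route to the barrier-in-class question (cell file `repair/p4/Q2-ARCHITECTURE.md`).

In the main-term dictionary of the audit (pub-zhang `STRUCTURE.md` §§1, 4; kernel: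
`MainTermFormPSD.mainTermForm`, `MainTermFormCauchySchwarz.mainTermFormPolar`) the mollifier half
`H₂` of the test vector `𝔥 = H₁ + Z(s,χψ)H̄₂` ((2.27)) enters the glued profile on `[0,1]` through
the REFLECTION `(R̃g)(y) = conj g(1 − y)` — the profile image of the functional equation /
approximate functional equation `n ↦ pDt₀/n` (§11 Lemma 11.2, §12 (12.6)–(12.8), (2.30)). This file
proves the two symmetry facts the glued description rests on (`STRUCTURE.md` §4, "Symmetry:
`𝔅(R̃𝔤, R̃𝔥) = conj 𝔅(𝔤,𝔥)` (antiunitary; exact in the code) — the functional equation"), for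
arbitrary interval-integrable profiles:

* `reflProfile g`, `reflDeriv g'` — `R̃g` and its derivative companion `y ↦ −conj g′(1−y)`;
  `reflProfile_reflProfile` (involution), `integral_reflProfile` (`∫₀ˣ R̃g = conj ∫_{1−x}^1 g`);
* `mainTermForm_refl` — **`𝔅(R̃g, R̃g) = 𝔅(g, g)`** (`(8/π)‖g′‖²`, `88π‖g‖²` are invariant; the two
  `Im`-terms are invariant because `Im(−conj z) = Im z` and, for the primitive term,
  `S_{R̃g}(y) = conj(I − S_g(1−y))` with `∫₀¹ conj g · I = |I|²` real; the boundary terms swap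
  `g(0) ↔ conj g(1)`);
* `mainTermFormPolar_refl` — **`P(R̃u, R̃v) = conj P(u, v)`** (antiunitarity of the polar form; the
  sesquilinear form `s` itself picks up the two terms `−48π²i I_v Ī_u` and
  `−16i(ū(1)v(0) + ū(0)v(1))`, which cancel in the Hermitian part).

Consequences used downstream (glued profile `𝔤 = g₁ + R̃g₂` of a design, `RepairGluedProfile`):
`𝔅(R̃g₂) = 𝔅(g₂)` (the `𝔠₂`-block of (9.7) is the form value of the UNREFLECTED `H₂`-profile, as
the one-sided pair-block dictionary computes it), and the cross slot `2 Re P(g₁, R̃g₂)`.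
Pure calculus (change of variables `y ↦ 1−y`, `∫ conj = conj ∫`); no new `Prop` facts.
-/

noncomputable section

open MeasureTheory Set intervalIntegral
open scoped Real ComplexConjugate

namespace Literature.NumberTheory.LFunctions.Zhang2022

/-! ### The reflection and its calculus -/

/-- The functional-equation reflection of a profile on `[0,1]`: `(R̃g)(y) = conj g(1 − y)`
(pub-zhang `STRUCTURE.md` §1; the profile image of `n ↦ pDt₀/n`, §12 (12.6)–(12.8)).
[cite: Zhang2022LandauSiegel, §12 (12.6)–(12.8)] -/
def reflProfile (g : ℝ → ℂ) : ℝ → ℂ := fun y => conj (g (1 - y))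

/-- The derivative companion of `R̃g`: `y ↦ −conj g′(1 − y)`. [cite: Zhang2022LandauSiegel, §12 (12.6)–(12.8)] -/
def reflDeriv (g' : ℝ → ℂ) : ℝ → ℂ := fun y => -conj (g' (1 - y))

variable {g g' u u' v v' : ℝ → ℂ}

/-- `R̃` is an involution. [cite: Zhang2022LandauSiegel, §12 (12.6)–(12.8)] -/
@[simp] theorem reflProfile_reflProfile (g : ℝ → ℂ) : reflProfile (reflProfile g) = g := by
  funext y; simp [reflProfile]

/-- The derivative companion is an involution too. [cite: Zhang2022LandauSiegel, §12 (12.6)–(12.8)] -/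
@[simp] theorem reflDeriv_reflDeriv (g' : ℝ → ℂ) : reflDeriv (reflDeriv g') = g' := by
  funext y; simp [reflDeriv]

/-- [folklore] -/ @[simp] theorem reflProfile_zero (g : ℝ → ℂ) : reflProfile g 0 = conj (g 1) := by
  simp [reflProfile]
/-- [folklore] -/ @[simp] theorem reflProfile_one (g : ℝ → ℂ) : reflProfile g 1 = conj (g 0) := by
  simp [reflProfile]

/-- `∫ₐᵇ conj f = conj ∫ₐᵇ f` for interval integrals. [folklore] -/
private theorem intervalIntegral_conj (f : ℝ → ℂ) (a b : ℝ) :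
    ∫ x in a..b, conj (f x) = conj (∫ x in a..b, f x) := by
  simp only [intervalIntegral, integral_conj, map_sub]

/-- `∫₀¹ F(1 − x) dx = ∫₀¹ F(x) dx`. [folklore] -/
private theorem integral_unit_comp_one_sub {E : Type*} [NormedAddCommGroup E] [NormedSpace ℝ E]
    (F : ℝ → E) : ∫ x in (0:ℝ)..1, F (1 - x) = ∫ x in (0:ℝ)..1, F x := by
  rw [intervalIntegral.integral_comp_sub_left F 1]
  norm_num

/-- `∫₀¹ conj F(1 − x) dx = conj ∫₀¹ F`. [folklore] -/
private theorem integral_unit_conj_comp_one_sub (F : ℝ → ℂ) :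
    ∫ x in (0:ℝ)..1, conj (F (1 - x)) = conj (∫ x in (0:ℝ)..1, F x) := by
  rw [← intervalIntegral_conj]
  exact integral_unit_comp_one_sub (fun x => conj (F x))

/-- The primitive of the reflected profile: `∫₀ˣ R̃g = conj ∫_{1−x}^1 g`.
[cite: Zhang2022LandauSiegel, §12 (12.6)–(12.8)] -/
theorem integral_reflProfile (g : ℝ → ℂ) (x : ℝ) :
    ∫ t in (0:ℝ)..x, reflProfile g t = conj (∫ t in (1 - x)..1, g t) := by
  unfold reflProfile
  rw [intervalIntegral_conj, intervalIntegral.integral_comp_sub_left (fun t => g t) 1]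
  simp

/-- Total mass: `∫₀¹ R̃g = conj ∫₀¹ g`. [cite: Zhang2022LandauSiegel, §12 (12.6)–(12.8)] -/
theorem integral_reflProfile_one (g : ℝ → ℂ) :
    ∫ t in (0:ℝ)..1, reflProfile g t = conj (∫ t in (0:ℝ)..1, g t) := by
  rw [integral_reflProfile]; norm_num

/-- With `I = ∫₀¹ g`, `S(y) = ∫₀ʸ g`: `∫_{y}^1 g = I − S(y)` for interval-integrable `g`. [folklore] -/
private theorem integral_tail_eq (hg : IntervalIntegrable g volume 0 1) {y : ℝ}
    (hy : y ∈ uIcc (0:ℝ) 1) :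
    ∫ t in y..1, g t = (∫ t in (0:ℝ)..1, g t) - ∫ t in (0:ℝ)..y, g t := by
  rw [uIcc_of_le zero_le_one] at hy
  have h1 : IntervalIntegrable g volume 0 y := hg.mono_set (by
    rw [uIcc_of_le zero_le_one, uIcc_of_le hy.1]; exact Icc_subset_Icc_right hy.2)
  have h2 : IntervalIntegrable g volume y 1 := hg.mono_set (by
    rw [uIcc_of_le zero_le_one, uIcc_of_le hy.2]; exact Icc_subset_Icc_left hy.1)
  rw [← intervalIntegral.integral_add_adjacent_intervals h1 h2]
  ring

/-- Continuity on `[0,1]` gives interval integrability. [folklore] -/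
private theorem intervalIntegrable_of_continuousOn_unit (hc : ContinuousOn g (Icc 0 1)) :
    IntervalIntegrable g volume 0 1 :=
  hc.intervalIntegrable_of_Icc zero_le_one

/-- The primitive term of `𝔅` under reflection:
`∫₀¹ R̃g · conj S_{R̃g} = |I|² − conj ∫₀¹ g · conj S_g` (`g` continuous on `[0,1]`).
[cite: Zhang2022LandauSiegel, §12 (12.6)–(12.8)] -/
theorem integral_refl_mul_conj_primitive (hc : ContinuousOn g (Icc 0 1)) :
    (∫ x in (0:ℝ)..1, reflProfile g x * conj (∫ t in (0:ℝ)..x, reflProfile g t))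
      = (∫ t in (0:ℝ)..1, g t) * conj (∫ t in (0:ℝ)..1, g t)
        - conj (∫ x in (0:ℝ)..1, g x * conj (∫ t in (0:ℝ)..x, g t)) := by
  have hg := intervalIntegrable_of_continuousOn_unit hc
  have hF : ∀ x, reflProfile g x * conj (∫ t in (0:ℝ)..x, reflProfile g t)
      = (fun y => conj (g y) * ∫ t in y..1, g t) (1 - x) := by
    intro x
    rw [integral_reflProfile]
    simp only [reflProfile, Complex.conj_conj]
  simp_rw [hF]
  rw [integral_unit_comp_one_sub (fun y => conj (g y) * ∫ t in y..1, g t)]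
  have hcongr : ∫ y in (0:ℝ)..1, conj (g y) * ∫ t in y..1, g t
      = ∫ y in (0:ℝ)..1, (conj (g y) * (∫ t in (0:ℝ)..1, g t)
          - conj (g y * conj (∫ t in (0:ℝ)..y, g t))) := by
    refine intervalIntegral.integral_congr fun y hy => ?_
    simp only [integral_tail_eq hg hy, map_mul, Complex.conj_conj]
    ring
  rw [hcongr]
  have hi1 : IntervalIntegrable (fun y => conj (g y) * ∫ t in (0:ℝ)..1, g t) volume 0 1 :=
    ((continuousOn_conj_comp hc).mul continuousOn_const).intervalIntegrable_of_Icc zero_le_one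
  have hi2 : IntervalIntegrable (fun y => conj (g y * conj (∫ t in (0:ℝ)..y, g t))) volume 0 1 :=
    (continuousOn_conj_comp (hc.mul (continuousOn_conj_comp (continuousOn_primitive_unit hc))))
      |>.intervalIntegrable_of_Icc zero_le_one
  rw [intervalIntegral.integral_sub hi1 hi2, intervalIntegral_conj,
    intervalIntegral.integral_mul_const, intervalIntegral_conj]
  ring

/-! ### `𝔅` is reflection-invariant -/

/-- **`𝔅(R̃g) = 𝔅(g)`**: the main-term form is invariant under the functional-equation reflection
(pub-zhang `STRUCTURE.md` §4, "Symmetry"), for every profile `g` continuous on `[0,1]` and every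
derivative companion `g′`. [cite: Zhang2022LandauSiegel, §12 (12.6)–(12.8)] -/
theorem mainTermForm_refl (hc : ContinuousOn g (Icc 0 1)) (g' : ℝ → ℂ) :
    mainTermForm (reflProfile g) (reflDeriv g') = mainTermForm g g' := by
  rw [mainTermForm_eq, mainTermForm_eq]
  -- (1) ‖(R̃g)′‖²
  have h1 : (∫ x in (0:ℝ)..1, ‖reflDeriv g' x‖ ^ 2) = ∫ x in (0:ℝ)..1, ‖g' x‖ ^ 2 := by
    have := integral_unit_comp_one_sub (fun x => ‖g' x‖ ^ 2)
    simpa only [reflDeriv, norm_neg, Complex.norm_conj] using this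
  -- (2) ∫ (R̃g)′ · conj R̃g = − conj ∫ g′ · conj g
  have h2 : (∫ x in (0:ℝ)..1, reflDeriv g' x * conj (reflProfile g x))
      = -conj (∫ x in (0:ℝ)..1, g' x * conj (g x)) := by
    have hs := integral_unit_conj_comp_one_sub (fun x => g' x * conj (g x))
    beta_reduce at hs
    rw [← hs, ← intervalIntegral.integral_neg]
    refine intervalIntegral.integral_congr fun x _ => ?_
    simp only [reflDeriv, reflProfile, map_mul, Complex.conj_conj]
    ring
  -- (3) ‖R̃g‖²
  have h3 : (∫ x in (0:ℝ)..1, ‖reflProfile g x‖ ^ 2) = ∫ x in (0:ℝ)..1, ‖g x‖ ^ 2 := by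
    have := integral_unit_comp_one_sub (fun x => ‖g x‖ ^ 2)
    simpa only [reflProfile, Complex.norm_conj] using this
  -- (4) the primitive term
  have h4 := integral_refl_mul_conj_primitive hc
  -- (5) total mass and boundary values
  have h5 := integral_reflProfile_one g
  rw [h1, h2, h3, h4, h5, reflProfile_zero, reflProfile_one]
  -- the remaining identity is algebra in re/im parts
  have hII : ((∫ t in (0:ℝ)..1, g t) * conj (∫ t in (0:ℝ)..1, g t)).im = 0 := by
    rw [Complex.mul_conj]; simp
  simp only [Complex.neg_im, Complex.conj_im, Complex.sub_im, Complex.conj_conj,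
    Complex.mul_re, Complex.mul_im, Complex.conj_re, Complex.add_re, Complex.add_im, neg_neg,
    hII]
  ring

/-! ### The polar form is antiunitary under reflection -/

/-- The sesquilinear form under reflection, term by term: `s(R̃u, R̃v)` equals `conj s(u,v)` up to
the two terms `−48π²i I_v conj I_u` and `−16i(conj u(1)·v(0) + conj u(0)·v(1))`, whose
Hermitian parts vanish, so that they cancel in the polar form. [cite: Zhang2022LandauSiegel, §12 (12.6)–(12.8)] -/
theorem mainTermFormSesq_refl (hu : ContinuousOn u (Icc 0 1)) (hv : ContinuousOn v (Icc 0 1))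
    (u' v' : ℝ → ℂ) :
    mainTermFormSesq (reflProfile u) (reflDeriv u') (reflProfile v) (reflDeriv v')
      = conj (mainTermFormSesq u u' v v')
        - ((48 * π ^ 2 : ℝ) : ℂ) * Complex.I *
            ((∫ t in (0:ℝ)..1, v t) * conj (∫ t in (0:ℝ)..1, u t))
        - ((16 : ℝ) : ℂ) * Complex.I * (conj (u 1) * v 0 + conj (u 0) * v 1) := by
  have hvI := intervalIntegrable_of_continuousOn_unit hv
  -- (1)
  have h1 : (∫ x in (0:ℝ)..1, reflDeriv u' x * conj (reflDeriv v' x))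
      = conj (∫ x in (0:ℝ)..1, u' x * conj (v' x)) := by
    have hs := integral_unit_conj_comp_one_sub (fun x => u' x * conj (v' x))
    beta_reduce at hs
    rw [← hs]
    refine intervalIntegral.integral_congr fun x _ => ?_
    simp only [reflDeriv, map_mul, Complex.conj_conj, map_neg]
    ring
  -- (2)
  have h2 : (∫ x in (0:ℝ)..1, reflDeriv u' x * conj (reflProfile v x))
      = -conj (∫ x in (0:ℝ)..1, u' x * conj (v x)) := by
    have hs := integral_unit_conj_comp_one_sub (fun x => u' x * conj (v x))
    beta_reduce at hs
    rw [← hs, ← intervalIntegral.integral_neg]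
    refine intervalIntegral.integral_congr fun x _ => ?_
    simp only [reflDeriv, reflProfile, map_mul, Complex.conj_conj]
    ring
  -- (3)
  have h3 : (∫ x in (0:ℝ)..1, reflProfile u x * conj (reflProfile v x))
      = conj (∫ x in (0:ℝ)..1, u x * conj (v x)) := by
    have hs := integral_unit_conj_comp_one_sub (fun x => u x * conj (v x))
    beta_reduce at hs
    rw [← hs]
    refine intervalIntegral.integral_congr fun x _ => ?_
    simp only [reflProfile, map_mul, Complex.conj_conj]
  -- (4) ∫ R̃u · conj S_{R̃v} = I_v conj I_u − conj ∫ u conj S_v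
  have h4 : (∫ x in (0:ℝ)..1, reflProfile u x * conj (∫ t in (0:ℝ)..x, reflProfile v t))
      = (∫ t in (0:ℝ)..1, v t) * conj (∫ t in (0:ℝ)..1, u t)
        - conj (∫ x in (0:ℝ)..1, u x * conj (∫ t in (0:ℝ)..x, v t)) := by
    have hF : ∀ x, reflProfile u x * conj (∫ t in (0:ℝ)..x, reflProfile v t)
        = (fun y => conj (u y) * ∫ t in y..1, v t) (1 - x) := by
      intro x
      rw [integral_reflProfile]
      simp only [reflProfile, Complex.conj_conj]
    simp_rw [hF]
    rw [integral_unit_comp_one_sub (fun y => conj (u y) * ∫ t in y..1, v t)]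
    have hcongr : ∫ y in (0:ℝ)..1, conj (u y) * ∫ t in y..1, v t
        = ∫ y in (0:ℝ)..1, (conj (u y) * (∫ t in (0:ℝ)..1, v t)
            - conj (u y * conj (∫ t in (0:ℝ)..y, v t))) := by
      refine intervalIntegral.integral_congr fun y hy => ?_
      simp only [integral_tail_eq hvI hy, map_mul, Complex.conj_conj]
      ring
    rw [hcongr]
    have hi1 : IntervalIntegrable (fun y => conj (u y) * ∫ t in (0:ℝ)..1, v t) volume 0 1 :=
      ((continuousOn_conj_comp hu).mul continuousOn_const).intervalIntegrable_of_Icc zero_le_one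
    have hi2 : IntervalIntegrable (fun y => conj (u y * conj (∫ t in (0:ℝ)..y, v t))) volume 0 1 :=
      (continuousOn_conj_comp (hu.mul (continuousOn_conj_comp (continuousOn_primitive_unit hv))))
        |>.intervalIntegrable_of_Icc zero_le_one
    rw [intervalIntegral.integral_sub hi1 hi2, intervalIntegral_conj,
      intervalIntegral.integral_mul_const, intervalIntegral_conj]
    ring
  have h5 := integral_reflProfile_one v
  unfold mainTermFormSesq
  rw [h1, h2, h3, h4, h5, reflProfile_zero, reflProfile_one, reflProfile_one]
  simp only [map_add, map_sub, map_mul, Complex.conj_conj, Complex.conj_ofReal, Complex.conj_I]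
  ring

/-- **`P(R̃u, R̃v) = conj P(u, v)`**: the polar (Hermitian) form of `𝔅` is antiunitary under the
functional-equation reflection (pub-zhang `STRUCTURE.md` §4). [cite: Zhang2022LandauSiegel, §12 (12.6)–(12.8)] -/
theorem mainTermFormPolar_refl (hu : ContinuousOn u (Icc 0 1)) (hv : ContinuousOn v (Icc 0 1))
    (u' v' : ℝ → ℂ) :
    mainTermFormPolar (reflProfile u) (reflDeriv u') (reflProfile v) (reflDeriv v')
      = conj (mainTermFormPolar u u' v v') := by
  unfold mainTermFormPolar
  rw [mainTermFormSesq_refl hu hv, mainTermFormSesq_refl hv hu]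
  simp only [map_add, map_sub, map_mul, map_div₀, Complex.conj_conj, Complex.conj_ofReal,
    Complex.conj_I, Complex.conj_ofNat]
  ring

/-- The mixed value `P(g, R̃h)` is the conjugate of `P(R̃g, h)` (reflect both sides and use the
involution). [cite: Zhang2022LandauSiegel, §12 (12.6)–(12.8)] -/
theorem mainTermFormPolar_refl_right (hu : ContinuousOn u (Icc 0 1)) (hv : ContinuousOn v (Icc 0 1))
    (u' v' : ℝ → ℂ) :
    mainTermFormPolar u u' (reflProfile v) (reflDeriv v')
      = conj (mainTermFormPolar (reflProfile u) (reflDeriv u') v v') := by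
  have hru : ContinuousOn (reflProfile u) (Icc 0 1) := by
    unfold reflProfile
    refine continuousOn_conj_comp (hu.comp (continuousOn_const.sub continuousOn_id) ?_)
    intro y hy; exact ⟨by linarith [hy.2], by linarith [hy.1]⟩
  have := mainTermFormPolar_refl hru hv (reflDeriv u') v'
  simpa only [reflProfile_reflProfile, reflDeriv_reflDeriv] using this

end Literature.NumberTheory.LFunctions.Zhang2022
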